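import Summits.ResolutionOfSingularities.ResolutionOfSingularities.Theorems.EquisingularLiftEquisingularLiftNatProjectiveSpaceCoordLineDirStepUnobs
import Summits.ResolutionOfSingularities.ResolutionOfSingularities.Theorems.EquisingularLiftEquisingularLiftNatDirStepUnobsHostChange
import HarnessLib

/-!
# [OURS · L1 W4.5(b) · EL♮(3) · nose residue / NEST centres, brick N-8 (door)] The coordinate-line certificate ALONG ANY ISOMORPHISM:
# `DirStepUnobs Y univ _ (φ '' V₊(x₂, …, x_{m+1}))` for every reduced `Y` and every `φ : ℙ^{m+1}_K ≅ Y`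

Cell `res-hironaka`, LADDER-RESOLUTION rung L (D-0089), slot W4.5(b), crux chain w45b: child crux **EL♮(3)** =
stmt-ResolutionOfSingularities-20148, parent EL♮ = stmt-…-20038. WIDTH seat res-L1-w45b-nose-w1 g2 (D-0157 DOOR 1), brick N-8 (door) over
✓ p663259 `PnLine.dirStepUnobs_coordLine`. `--supports stmt-ResolutionOfSingularities-20148 --as helper`. OURS; NOT a statement of
H. Hironaka's 2017 manuscript (nothing of [Hironaka2017] is asserted); AI-written, AI review weaker than expert review. DEF-FREE; no `sorry`; standard
axioms. EL♮(3) is NOT proved here; resolution in positive characteristic is NOT proved here (dimension 3 is Cossart–Piltant 2008/2009 in print).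

WHAT. `PnLine.dirStepUnobs_coordLine_of_iso (K) (m) {Y} [IsReduced Y] (φ : ℙ^{m+1}_K ≅ Y) (hZ) : DirStepUnobs Y Set.univ isClosed_univ (φ '' Λ) hZ`
(`Λ = V₊(x₂, …, x_{m+1})`): res-L1-w45b-iso-w4's transport pattern ✓ `S10Conic.dirStepUnobs_conic_of_iso` (B0 `dirStepUnobs_transport` along `φ.hom`
with res-L1-w45b-iso-w2's ✓ `exists_isIso_redSub_univ_over` / `exists_isIso_redSub_image`) applied to ✓ `PnLine.dirStepUnobs_coordLine`. With
iso-w4's ✓ `ProjLin.exists_iso_image_zeroLocus` (linear automorphisms of `ℙⁿ` as scheme isomorphisms transporting zero loci) this makes every line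
that is a linear image of the coordinate line — i.e. EVERY LINE of `ℙ^{m+1}_K` once written as such an image — an unobstructed centre at host `univ`
(`m = 1`: lines in the fresh plane `E_q ≅ ℙ²`, the NEST-centre shape of R39 (i), through iso-w2's ✓ D3-10 `dirStepUnobs_of_model_iso`).

References (index only): R. Hartshorne, *Algebraic Geometry* (1977), III Thm. 5.1 [cite: Hartshorne1977].
-/

set_option linter.dupNamespace false -- mandated namespace `Summit.<Summit>.<Problem>` of this single-conjunct summit

noncomputable section

-- `TopCat.Presheaf`/`Scheme.Modules` are not reducible (as in Mathlib's `AlgebraicGeometry/Modules`).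
set_option backward.isDefEq.respectTransparency false

open CategoryTheory CategoryTheory.Limits AlgebraicGeometry TopologicalSpace
open MvPolynomial
open Literature.AlgebraicGeometry.Resolution
open Literature.AlgebraicGeometry.Motives

namespace Summit.ResolutionOfSingularities.ResolutionOfSingularities.Cruxes.EquisingularLiftNat.Sections

namespace PnLine

variable (K : Type) [Field K] (m : ℕ)

attribute [local instance] MvPolynomial.gradedAlgebra

/-- ★★ **THE COORDINATE-LINE CERTIFICATE ALONG ANY ISOMORPHISM.** For a reduced scheme `Y` and an isomorphism `φ : ℙ^{m+1}_K ≅ Y`, the image of the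
coordinate line `Λ = V₊(x₂, …, x_{m+1})` is unobstructed in `Y` at host `univ`: `DirStepUnobs Y univ _ (φ '' Λ) hZ` for every closedness witness `hZ`
(B0 transport of ✓ `PnLine.dirStepUnobs_coordLine` along `φ.hom`; pattern of ✓ `S10Conic.dirStepUnobs_conic_of_iso`).
[OURS · L1 W4.5b · EL♮(3) · N-8 door; NOT a statement of the manuscript; EL♮(3) NOT proved] [cite: Hartshorne1977, III Thm. 5.1] -/
theorem dirStepUnobs_coordLine_of_iso {Y : Scheme.{0}} [IsReduced Y]
    (φ : Proj (MvPolynomial.homogeneousSubmodule (Fin (1 + m + 1)) K) ≅ Y)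
    (hZ : IsClosed ((φ.hom : Proj (MvPolynomial.homogeneousSubmodule (Fin (1 + m + 1)) K) → Y) ''
      {y : Proj (MvPolynomial.homogeneousSubmodule (Fin (1 + m + 1)) K) |
        ∀ k : Fin m, (X (⟨(k : ℕ) + 2, by omega⟩ : Fin (1 + m + 1)) : MvPolynomial (Fin (1 + m + 1)) K) ∈ y.asHomogeneousIdeal})) :
    DirStepUnobs Y Set.univ isClosed_univ
      ((φ.hom : Proj (MvPolynomial.homogeneousSubmodule (Fin (1 + m + 1)) K) → Y) ''
        {y : Proj (MvPolynomial.homogeneousSubmodule (Fin (1 + m + 1)) K) |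
          ∀ k : Fin m, (X (⟨(k : ℕ) + 2, by omega⟩ : Fin (1 + m + 1)) : MvPolynomial (Fin (1 + m + 1)) K) ∈ y.asHomogeneousIdeal}) hZ := by
  haveI : IsReduced (Proj (MvPolynomial.homogeneousSubmodule (Fin (1 + m + 1)) K)) := Proj.isReduced _
  -- the isomorphism of the reduced structures at host `univ`, over `φ.hom`
  obtain ⟨ε, hε, hεiso⟩ := exists_isIso_redSub_univ_over φ.hom
  haveI := hεiso
  -- the induced isomorphism of the reduced line onto the reduced image
  obtain ⟨hc, εZ, hεZ, hεZiso⟩ := exists_isIso_redSub_image φ.hom (E := Set.univ) isClosed_univ isClosed_univ ε hε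
    (isClosed_coordLine K m) (Set.subset_univ _)
  exact dirStepUnobs_transport (Proj (MvPolynomial.homogeneousSubmodule (Fin (1 + m + 1)) K)) Set.univ isClosed_univ _ _ Y φ.hom Set.univ
    isClosed_univ _ hc ε εZ (Set.subset_univ _) (Set.subset_univ _) hεiso hε hεZiso hεZ (dirStepUnobs_coordLine K m)

end PnLine

end Summit.ResolutionOfSingularities.ResolutionOfSingularities.Cruxes.EquisingularLiftNat.Sections

end
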